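import Summits.HodgeConjecture.HodgeConjecture.Theorems.A3Liu418S34ClauseOneOfGS
import Summits.HodgeConjecture.CorCM.HermSpaceTransport
import Literature.AlgebraicGeometry.ShimuraVarieties.UnitaryShimuraCurveRecordEmpty
import HarnessLib

/-!
# GS-6 hoist (β), junk branch at the face: a `frobeniusActsByGS` frame whose complement line is NEGATIVE at `ι₁` carries no GS record

Cell `hodgecm-mathlib` (D-0151), the `hLiu418` cone, row III-14 GS-6, (β) road (director hodgecm-mathlib g8 RULING s127, 2026-08-29T10:29Z),
placement row S-2 (face half of the junk branch; the generic half is `Literature/AlgebraicGeometry/ShimuraVarieties/UnitaryShimuraCurveRecordEmpty.lean`,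
row L-10).  The named fact `frobeniusActsByGS` quantifies over frames `ᵗ(cB)·(a′·H_V)·B = J⋆ ⊕ᶠ J⊥` with `0 < ι₁(a′)` real but WITHOUT
the positivity of the complement line `J⊥` at `ι₁`; at a frame with `Re ι₁(J⊥₀₀) < 0` the curve block `J⋆^{ι₁}` is positive SEMI-definite
(Sylvester count against the signature `(2,1)` of `H_V^{ι₁}`), so its negative cone is empty and — a GS record's `pieces` need a negative
vector — the binder `S : RecordSystemGS F J⋆ ι₁ K₀` is absurd: the junk branch of the glue's trichotomy on `Re ι₁(J⊥₀₀)` closes by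
`exfalso`, and the `= 0` case is void (`ι₁(J⊥₀₀)` is a non-zero real).

* §1 `gsFrame_re_hermForm_nonneg_of_neg` / `gsFrame_negCone_eq_empty_of_neg` — L-vac, the Sylvester count WITHOUT dimension theory: were `v`
  `J⋆^{ι₁}`-negative, every `w(α,β) := B^{ι₁}((α·v) ⊕ β)` would have `Re ι₁(a′)·Re⟪w,w⟫_{H_V} = |α|²·Re⟪v,v⟫_{J⋆} + |β|²·Re ι₁(J⊥₀₀) < 0`
  (★ `mul_hermForm_map_frameEmb_eq`) for `(α,β) ≠ 0`, while the one linear condition «third `T⁻¹`-coordinate of `w` vanishes»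
  (`T = frameOf V`, ★ `formCongr_frameOf`) has a non-trivial solution and gives `Re⟪w,w⟫ = |x₀|² + |x₁|² ≥ 0`.
* §2 `gsFrame_subformRight_ne_zero` / `gsFrame_im_subformRight_eq_zero` / `gsFrame_re_subformRight_ne_zero` — `ι₁(J⊥₀₀)` is a non-zero
  real (★ `det_formCongr`, ★ `det_finSum`, ★ `HermSpace3.det_ne_zero`; ★ `isHermitian_subform_right`).
* §3 `gsFrame_isEmpty_recordSystemGS_of_neg` / `gsFrame_false_of_neg` — composition with ★ `RecordSystemGS.isEmpty_of_negCone_eq_empty`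
  (row L-10).

Theorems only (no definition, no named fact, no `sorry`).  HC_CM is proved only modulo the 7 printed citations until rung 0 closes; this
file changes no count.

## References
* [Liu2021] Y. Liu, *Fourier–Jacobi cycles and arithmetic relative trace formula*, Camb. J. Math. 9 (2021) = arXiv:2102.11518: Thm. 4.15
  proof (FJcycle.tex l. 2193); App. D §D.3 l. 5355.
* [HornJohnson2013] R. Horn, C. Johnson, *Matrix Analysis* (2nd ed.), §4.5 Thm 4.5.8 (Sylvester's law of inertia).
* [BergeronMillsonMoeglin2016Balls] Part 2 §§1.1, 1.3, 3.1 (hermitian forms, negative cones, sub-forms).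
* [Deligne1979ShimuraVarieties] P. Deligne, *Variétés de Shimura*, 2.1.2 (complex points of the canonical model).
* [Dieudonne1971GroupesClassiques] J. Dieudonné, *La géométrie des groupes classiques*, Chap. II §5.
-/

set_option autoImplicit false

noncomputable section

namespace Summit.HodgeConjecture.CorCM.Lines.A3Liu418

open NumberField Matrix
open scoped Matrix ComplexOrder
open Literature.AlgebraicGeometry.ShimuraVarieties (negCone mem_negCone_iff)
open Literature.AlgebraicGeometry.ShimuraVarieties.UnitaryCanonicalModel
open Literature.NumberTheory.Automorphic Literature.NumberTheory.Automorphic.UnitaryGroup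
open Literature.NumberTheory.Automorphic.Liu2021.AppendixC (C5.OpenCompactSubgroup)
open Literature.Geometry.ComplexHyperbolic
open Summit.HodgeConjecture.CorCM.Model Summit.HodgeConjecture.CorCM.Model.HComp Summit.HodgeConjecture.CorCM.HComp

/-! ## §1 L-vac: the Sylvester count -/

section GSFrameVac

variable {F : CMField} {ι₁ : F →+* ℂ} (V : HermSpace3 F ι₁)
  (Jstar : Matrix (Fin 2) (Fin 2) F) (Jperp : Matrix (Fin 1) (Fin 1) F) (B : GL (Fin 3) F) {a' : F}
  (hB : formCongr ((IsCMField.complexConj F : F ≃ₐ[↥(maximalRealSubfield F)] F) : F →+* F) B (a' • V.Hm) =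
    finSum 2 1 Jstar Jperp)

/-- `⟪Tx, Tx⟫_{H_V^{ι₁}} = |x₀|² + |x₁|² − |x₂|²` for the record's frame `T = frameOf V` (★ `formCongr_frameOf V`), written as
`star x ⬝ᵥ (diag(1,1,−1) *ᵥ x)`. [cite: BergeronMillsonMoeglin2016Balls, Part 2 §1.3] -/
theorem hermForm_frameOf_mulVec (x : Fin 3 → ℂ) :
    hermForm (starRingEnd ℂ) (V.Hm.map ι₁) ((frameOf V : Matrix (Fin 3) (Fin 3) ℂ) *ᵥ x)
        ((frameOf V : Matrix (Fin 3) (Fin 3) ℂ) *ᵥ x) =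
      hermForm (starRingEnd ℂ) (Matrix.diagonal ![(1 : ℂ), 1, -1]) x x := by
  rw [hermForm_mulVec_mulVec_eq_hermForm_formCongr, formCongr_frameOf]
  rfl

/-- On vectors with vanishing third frame coordinate the `(2,1)`-form is non-negative: `Re ⟪Tx, Tx⟫ = |x₀|² + |x₁|² ≥ 0` when `x₂ = 0`.
[cite: HornJohnson2013, §4.5 Thm 4.5.8] -/
theorem re_hermForm_frameOf_mulVec_nonneg {x : Fin 3 → ℂ} (hx : x 2 = 0) :
    0 ≤ (hermForm (starRingEnd ℂ) (V.Hm.map ι₁) ((frameOf V : Matrix (Fin 3) (Fin 3) ℂ) *ᵥ x)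
        ((frameOf V : Matrix (Fin 3) (Fin 3) ℂ) *ᵥ x)).re := by
  rw [hermForm_frameOf_mulVec, hermForm_apply, dotProduct, Fin.sum_univ_three]
  simp only [mulVec_diagonal, Function.comp_apply, Matrix.cons_val_zero, Matrix.cons_val_one, Matrix.cons_val, hx,
    mul_zero, add_zero, one_mul, Complex.add_re, Complex.mul_re, Complex.conj_re, Complex.conj_im]
  nlinarith [sq_nonneg (x 0).re, sq_nonneg (x 0).im, sq_nonneg (x 1).re, sq_nonneg (x 1).im]

include hB in
/-- **L-vac (Sylvester count).**  If the complement line of the frame is NEGATIVE at `ι₁` (`Re ι₁(J⊥₀₀) < 0`) and `0 < ι₁(a′)` is real,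
then the curve block `J⋆^{ι₁}` has no negative vector: `0 ≤ Re (v̄ᵀ J⋆^{ι₁} v)` for every `v`.
[cite: HornJohnson2013, §4.5 Thm 4.5.8] [cite: BergeronMillsonMoeglin2016Balls, Part 2 §§1.1, 3.1] -/
theorem gsFrame_re_hermForm_nonneg_of_neg (hτa : 0 < (ι₁ a').re) (hτa' : (ι₁ a').im = 0) (hneg : (ι₁ (Jperp 0 0)).re < 0)
    (v : Fin 2 → ℂ) : 0 ≤ (star v ⬝ᵥ (Jstar.map ι₁ *ᵥ v)).re := by
  -- the frame equation in the `cmConjRingHom` spelling, and the intertwining `ι₁ ∘ c = conj ∘ ι₁`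
  have hBc : formCongr (cmConjRingHom F) B (a' • V.Hm) = finSum 2 1 Jstar Jperp := by
    rw [← coe_complexConj_eq_conjRingHomK' F]; exact hB
  have hτ := embedding_cmConjRingHom F ι₁
  by_contra hvneg
  rw [not_le] at hvneg
  have hv : (hermForm (starRingEnd ℂ) (Jstar.map ι₁) v v).re < 0 := by
    rw [hermForm_apply]
    have : (⇑(starRingEnd ℂ) ∘ v) = star v := funext fun i => by simp [Pi.star_apply]
    rw [this]; exact hvneg
  -- notation
  set Bc : Matrix (Fin 3) (Fin 3) ℂ := (B : Matrix (Fin 3) (Fin 3) F).map ι₁ with hBc_def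
  set T : Matrix (Fin 3) (Fin 3) ℂ := (frameOf V : Matrix (Fin 3) (Fin 3) ℂ) with hT_def
  set Ti : Matrix (Fin 3) (Fin 3) ℂ := (((frameOf V)⁻¹ : GL (Fin 3) ℂ) : Matrix (Fin 3) (Fin 3) ℂ) with hTi_def
  have hTTi : T * Ti = 1 := by
    rw [hT_def, hTi_def, ← Units.val_mul, mul_inv_cancel, Units.val_one]
  -- the test vectors `w(α, β) = Bc (α•v ⊕ β)` and the frame identity on them
  have key : ∀ α β : ℂ,
      ι₁ a' * hermForm (starRingEnd ℂ) (V.Hm.map ι₁) (Bc *ᵥ Fin.append (α • v) (fun _ : Fin 1 => β))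
          (Bc *ᵥ Fin.append (α • v) (fun _ : Fin 1 => β)) =
        starRingEnd ℂ α * α * hermForm (starRingEnd ℂ) (Jstar.map ι₁) v v +
          starRingEnd ℂ β * β * ι₁ (Jperp 0 0) := by
    intro α β
    rw [hBc_def, mul_hermForm_map_frameEmb_eq (N₁ := 2) (N₂ := 1) (cmConjRingHom F) ι₁ hτ hBc (α • v) (α • v) (fun _ => β) (fun _ => β)]
    congr 1
    · rw [hermForm_apply, hermForm_apply, mulVec_smul, dotProduct_smul, smul_eq_mul]
      have : (⇑(starRingEnd ℂ) ∘ (α • v)) = starRingEnd ℂ α • (⇑(starRingEnd ℂ) ∘ v) :=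
        funext fun i => by simp [Pi.smul_apply, smul_eq_mul, map_mul]
      rw [this, smul_dotProduct, smul_eq_mul]; ring
    · rw [hermForm_apply, dotProduct, Fin.sum_univ_one, mulVec, dotProduct, Fin.sum_univ_one]
      simp only [Function.comp_apply, Matrix.map_apply]; ring
  -- real parts: `Re (ι₁ a′ · ⟪w,w⟫) = |α|²·Re⟪v,v⟫_{J⋆} + |β|²·Re ι₁(J⊥₀₀)`
  have hre : ∀ α β : ℂ,
      (ι₁ a').re * (hermForm (starRingEnd ℂ) (V.Hm.map ι₁) (Bc *ᵥ Fin.append (α • v) (fun _ : Fin 1 => β))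
          (Bc *ᵥ Fin.append (α • v) (fun _ : Fin 1 => β))).re =
        Complex.normSq α * (hermForm (starRingEnd ℂ) (Jstar.map ι₁) v v).re + Complex.normSq β * (ι₁ (Jperp 0 0)).re := by
    intro α β
    have h := congrArg Complex.re (key α β)
    rw [Complex.mul_re, hτa', zero_mul, sub_zero] at h
    rw [h, ← Complex.normSq_eq_conj_mul_self, ← Complex.normSq_eq_conj_mul_self, Complex.add_re, Complex.re_ofReal_mul,
      Complex.re_ofReal_mul]
  -- the linear condition: third `T⁻¹`-coordinate of `w(α,β)` is `α c₁ + β c₂`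
  set w₁ : Fin 3 → ℂ := Bc *ᵥ Fin.append v (0 : Fin 1 → ℂ) with hw₁
  set w₂ : Fin 3 → ℂ := Bc *ᵥ Fin.append (0 : Fin 2 → ℂ) (fun _ : Fin 1 => (1 : ℂ)) with hw₂
  have happ : ∀ α β : ℂ, Fin.append (α • v) (fun _ : Fin 1 => β) =
      α • Fin.append v (0 : Fin 1 → ℂ) + β • Fin.append (0 : Fin 2 → ℂ) (fun _ : Fin 1 => (1 : ℂ)) := by
    intro α β; funext k
    induction k using Fin.addCases with
    | left i => simp [Fin.append_left]
    | right j => simp [Fin.append_right]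
  have hw : ∀ α β : ℂ, Bc *ᵥ Fin.append (α • v) (fun _ : Fin 1 => β) = α • w₁ + β • w₂ := by
    intro α β; rw [happ, mulVec_add, mulVec_smul, mulVec_smul]
  set c₁ : ℂ := (Ti *ᵥ w₁) 2 with hc₁
  set c₂ : ℂ := (Ti *ᵥ w₂) 2 with hc₂
  -- choose `(α, β) ≠ 0` with `α c₁ + β c₂ = 0`
  obtain ⟨α, β, hαβ, hlin⟩ : ∃ α β : ℂ, (α ≠ 0 ∨ β ≠ 0) ∧ α * c₁ + β * c₂ = 0 := by
    by_cases h1 : c₁ = 0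
    · exact ⟨1, 0, Or.inl one_ne_zero, by rw [h1, mul_zero, zero_mul, add_zero]⟩
    · exact ⟨c₂, -c₁, Or.inr (neg_ne_zero.mpr h1), by ring⟩
  -- `x := T⁻¹ w` has `x₂ = 0` and `T x = w`
  set x : Fin 3 → ℂ := Ti *ᵥ (α • w₁ + β • w₂) with hx
  have hx2 : x 2 = 0 := by
    rw [hx, mulVec_add, mulVec_smul, mulVec_smul]
    simp only [Pi.add_apply, Pi.smul_apply, smul_eq_mul]
    rw [← hc₁, ← hc₂]; exact hlin
  have hTx : T *ᵥ x = α • w₁ + β • w₂ := by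
    rw [hx, mulVec_mulVec, hTTi, one_mulVec]
  -- non-negativity from the positive side …
  have hpos : 0 ≤ (hermForm (starRingEnd ℂ) (V.Hm.map ι₁) (α • w₁ + β • w₂) (α • w₁ + β • w₂)).re := by
    rw [← hTx, hT_def]; exact re_hermForm_frameOf_mulVec_nonneg V hx2
  -- … and negativity from the frame identity
  have hlt : (ι₁ a').re * (hermForm (starRingEnd ℂ) (V.Hm.map ι₁) (α • w₁ + β • w₂) (α • w₁ + β • w₂)).re < 0 := by
    rw [← hw, hre]
    have h1 : Complex.normSq α * (hermForm (starRingEnd ℂ) (Jstar.map ι₁) v v).re ≤ 0 :=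
      mul_nonpos_of_nonneg_of_nonpos (Complex.normSq_nonneg α) hv.le
    have h2 : Complex.normSq β * (ι₁ (Jperp 0 0)).re ≤ 0 :=
      mul_nonpos_of_nonneg_of_nonpos (Complex.normSq_nonneg β) hneg.le
    rcases hαβ with hα | hβ
    · have : Complex.normSq α * (hermForm (starRingEnd ℂ) (Jstar.map ι₁) v v).re < 0 :=
        mul_neg_of_pos_of_neg (Complex.normSq_pos.mpr hα) hv
      linarith
    · have : Complex.normSq β * (ι₁ (Jperp 0 0)).re < 0 := mul_neg_of_pos_of_neg (Complex.normSq_pos.mpr hβ) hneg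
      linarith
  have : 0 ≤ (ι₁ a').re * (hermForm (starRingEnd ℂ) (V.Hm.map ι₁) (α • w₁ + β • w₂) (α • w₁ + β • w₂)).re :=
    mul_nonneg hτa.le hpos
  exact absurd hlt (not_lt.mpr this)

include hB in
/-- **The negative cone of `J⋆^{ι₁}` is EMPTY at such a frame** — hence (A-p18's `RecordSystemGS.isEmpty_of_negCone_eq_empty`:
the record's `pieces`/`hol` fields need a negative vector) no `S : RecordSystemGS F Jstar ι₁ K₀` exists and `frobeniusActsByGS` holds
there vacuously. [cite: BergeronMillsonMoeglin2016Balls, Part 2 §1.3] [cite: HornJohnson2013, §4.5 Thm 4.5.8] -/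
theorem gsFrame_negCone_eq_empty_of_neg (hτa : 0 < (ι₁ a').re) (hτa' : (ι₁ a').im = 0) (hneg : (ι₁ (Jperp 0 0)).re < 0) :
    negCone (Jstar.map ι₁) = ∅ :=
  Set.eq_empty_iff_forall_notMem.2 fun v hv =>
    (not_lt.2 (gsFrame_re_hermForm_nonneg_of_neg V Jstar Jperp B hB hτa hτa' hneg v)) (mem_negCone_iff.1 hv)

end GSFrameVac

/-! ## §2 The complement entry `ι₁(J⊥₀₀)` is a non-zero real -/

section GSFrameSubformRight

variable {F : CMField} {ι₁ : F →+* ℂ} (V : HermSpace3 F ι₁)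
  (Jstar : Matrix (Fin 2) (Fin 2) F) (Jperp : Matrix (Fin 1) (Fin 1) F) (B : GL (Fin 3) F) {a' : F} (ha : a' ≠ 0)
  (hB : formCongr ((IsCMField.complexConj F : F ≃ₐ[↥(maximalRealSubfield F)] F) : F →+* F) B (a' • V.Hm) =
    finSum 2 1 Jstar Jperp)

include ha hB in
/-- **`J⊥₀₀ ≠ 0`**: `det (J⋆ ⊕ᶠ J⊥) = det J⋆ · J⊥₀₀` equals `c(det B) · det (a′·H_V) · det B ≠ 0`.
[cite: Dieudonne1971GroupesClassiques, Chap. II §5] -/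
theorem gsFrame_subformRight_ne_zero : Jperp 0 0 ≠ 0 := by
  have hdet : (finSum 2 1 Jstar Jperp).det ≠ 0 := by
    rw [← hB, det_formCongr, Matrix.det_smul, Fintype.card_fin]
    refine mul_ne_zero (mul_ne_zero ?_ (mul_ne_zero (pow_ne_zero _ ha) (HermSpace3.det_ne_zero V))) ?_
    · exact (map_ne_zero _).2 (Matrix.GeneralLinearGroup.det_ne_zero B)
    · exact Matrix.GeneralLinearGroup.det_ne_zero B
  intro h0
  apply hdet
  rw [det_finSum, Matrix.det_fin_one, h0, mul_zero]

include hB in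
/-- **`ι₁(J⊥₀₀)` is real**: `a′` is `c`-fixed (its image under `ι₁` is real and `ι₁ ∘ c = conj ∘ ι₁`), so `J⊥` is `c`-hermitian
(★ `isHermitian_subform_right`) and its entry is `c`-fixed. [cite: BergeronMillsonMoeglin2016Balls, Part 2 §1.1] -/
theorem gsFrame_im_subformRight_eq_zero (hτa' : (ι₁ a').im = 0) : (ι₁ (Jperp 0 0)).im = 0 := by
  have hτ := embedding_cmConjRingHom F ι₁
  have hBc : formCongr (cmConjRingHom F) B (a' • V.Hm) = finSum 2 1 Jstar Jperp := by
    rw [← coe_complexConj_eq_conjRingHomK' F]; exact hB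
  -- `c a′ = a′`
  have hca : cmConjRingHom F a' = a' := ι₁.injective (by rw [hτ, Complex.conj_eq_iff_im, hτa'])
  have hherm := isHermitian_subform_right (N₁ := 2) (N₂ := 1) (cmConjRingHom F) (IsCMField.complexConj_apply_apply (K := F))
    (gsFace_transpose_map_Hm V) hca hBc
  have hfix : cmConjRingHom F (Jperp 0 0) = Jperp 0 0 := by
    have h := congrFun (congrFun hherm 0) 0
    rwa [transpose_apply, map_apply] at h
  have hconj : starRingEnd ℂ (ι₁ (Jperp 0 0)) = ι₁ (Jperp 0 0) := by rw [← hτ, hfix]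
  exact Complex.conj_eq_iff_im.1 hconj

include ha hB in
/-- **`Re ι₁(J⊥₀₀) ≠ 0`** — the `= 0` case of the sign trichotomy on the complement line is void.
[cite: BergeronMillsonMoeglin2016Balls, Part 2 §3.1] -/
theorem gsFrame_re_subformRight_ne_zero (hτa' : (ι₁ a').im = 0) : (ι₁ (Jperp 0 0)).re ≠ 0 := by
  intro hre
  have him := gsFrame_im_subformRight_eq_zero V Jstar Jperp B hB hτa'
  have h0 : ι₁ (Jperp 0 0) = 0 := Complex.ext hre him
  exact gsFrame_subformRight_ne_zero V Jstar Jperp B ha hB (ι₁.injective (by rw [h0, map_zero]))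

end GSFrameSubformRight

/-! ## §3 The record binder is absurd at such frames -/

section Junction

variable {F : CMField} {ι₁ : F →+* ℂ} (V : HermSpace3 F ι₁)
  (Jstar : Matrix (Fin 2) (Fin 2) F) (Jperp : Matrix (Fin 1) (Fin 1) F) (B : GL (Fin 3) F) {a' : F}
  (hB : formCongr ((IsCMField.complexConj F : F ≃ₐ[↥(maximalRealSubfield F)] F) : F →+* F) B (a' • V.Hm) =
    finSum 2 1 Jstar Jperp)

include hB in
/-- **No canonical-model record over `J⋆` at such a frame**: its `pieces` need a negative vector of `J⋆^{ι₁}` (★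
`RecordSystemGS.isEmpty_of_negCone_eq_empty`), and there is none (§1). [cite: Deligne1979ShimuraVarieties, 2.1.2]
[cite: HornJohnson2013, §4.5 Thm 4.5.8] -/
theorem gsFrame_isEmpty_recordSystemGS_of_neg (hτa : 0 < (ι₁ a').re) (hτa' : (ι₁ a').im = 0) (hneg : (ι₁ (Jperp 0 0)).re < 0)
    (K₀ : C5.OpenCompactSubgroup ↥(finAdelic (↥(maximalRealSubfield F)) F (IsCMField.complexConj F) 2 Jstar)) :
    IsEmpty (RecordSystemGS (F : Type) Jstar ι₁ K₀) :=
  RecordSystemGS.isEmpty_of_negCone_eq_empty (gsFrame_negCone_eq_empty_of_neg V Jstar Jperp B hB hτa hτa' hneg)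

include hB in
/-- … so a record binder `S : RecordSystemGS F J⋆ ι₁ K₀` at such a frame is absurd (the junk branch of the glue discharges by `exfalso`).
[cite: Deligne1979ShimuraVarieties, 2.1.2] -/
theorem gsFrame_false_of_neg (hτa : 0 < (ι₁ a').re) (hτa' : (ι₁ a').im = 0) (hneg : (ι₁ (Jperp 0 0)).re < 0)
    {K₀ : C5.OpenCompactSubgroup ↥(finAdelic (↥(maximalRealSubfield F)) F (IsCMField.complexConj F) 2 Jstar)}
    (S : RecordSystemGS (F : Type) Jstar ι₁ K₀) : False :=
  (gsFrame_isEmpty_recordSystemGS_of_neg V Jstar Jperp B hB hτa hτa' hneg K₀).false S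

end Junction

end Summit.HodgeConjecture.CorCM.Lines.A3Liu418

end
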